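import Summits.ValiantsHypothesis.ValiantsHypothesis.Theorems.BarrierLeverDefinableEquationsLevelOne
import Summits.ValiantsHypothesis.ValiantsHypothesis.Theorems.BarrierLeverSuccinctHittingSetsForVPLevelOne
import HarnessLib

/-!
# Uniform succinctness — the DISTINGUISHER DILATION (workshop scratch, OFFER-lite O-L2-31)

Decomposition workshop `decomp-valiant`, lens 2 (natural-proofs / succinctness axis), generation 65.
LANDED on the critic's CALL GO O-L2-31 (workshop bus `run/shared/lean/pub/decomp-valiant/STATUS.md` line 3011, decomp-val-crit-1 g11, 2026-08-31T19:24:45Z) by lens-2 generation 66, on the lane `ledger propose --kind proof --target Summits/ValiantsHypothesis/ValiantsHypothesis/Theorems/BarrierLeverSuccinctHittingSetsForVPUniform.lean --supports stmt-ValiantsHypothesis-14610 --as helper --cite ForbesShpilkaVolk2018`;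
declarations token-identical to the workshop scratch `HOME/decomp-val-lens-2/g65/UniformSuccinctness.lean` (sha256 985f1853e176aafedd4a68878c8803ff8c83b1ccf3076fa91ab6f995f040d37d, re-checked by the critic before the CALL); a helper on the crux item stmt-ValiantsHypothesis-14610 (`BarrierLever.SuccinctHittingSetsForVP`), which stays OPEN.

HONEST BOUNDARY: 0 S-currency; closes NO item; an EQUIVALENT FORM of the crux Q6 = SuccinctHittingSetsForVP ℂ (its quantifier shape: ∀ a ∃ b ⟺ ∃ b ∀ a), taking no side on Q6; the cell c116 «size-exponent dial» stays NO-CELL (exact, zero-sum); stmt-14610 / SuccinctLift / VP ≠ VNP untouched.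

LABEL (critic ruling, bus line 3011 (6), verbatim): «O-L2-31 (lens-2 g65→): ELEMENTARY · VARIANT (the tree's own padding / restrict-and-truncate lever — `Dilation.eq_dilate`, `Dilation.exists_restrict`, `Dilation.restrict_arith`, `Dilation.pow_centralChoose_le_of_le` — transposed from boolean-sum EQUATIONS to DISTINGUISHERS; folklore padding, print-unstated, kernel-new) ·
EQUIV of the crux with a one-sided MAP gain (the refuter's burden on stmt-14610 is level-free: per b, any level a(b), i.o. — equivalently level ONE i.o.) · BC9 ceiling of the natural method under Q6 = ONE size n^{b*} for all levels and targets · 0 S-currency · closes NO item · c116 no-cell · VP ≠ VNP untouched»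

## What is proved (def-free; all statements over the Literature constants of
`Literature/Barriers/ValiantsHypothesis/AlgebraicNaturalProofs.lean`)

Write `hit(n, b, a)` for
`IsSuccinctHittingSet (degLEMonomials n) (SmallCircuits ℂ n b) (Distinguishers ℂ n a)`
("the coefficient vectors of degree-`≤ n`, size-`≤ n^b` polynomials hit every nonzero distinguisher
of size and degree `≤ N^a`, `N = C(2n,n)`"), and `Q6 := SuccinctHittingSetsForVP ℂ`
`= ∀ a, ∃ b n₀, ∀ n ≥ n₀, hit(n, b, a)` (Forbes–Shpilka–Volk, Question 6, over `ℂ`).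

* `Uniform.hit_dilate` — **the distinguisher dilation**: for `1 ≤ A`, `n ≥ 8 (2A)^(b+1) + 2` and
  `A n ≤ n' < A (n + 1)`, `hit(n', b, 1) → hit(n, b + 4, A)`.  (Pad a level-`A` distinguisher in the
  `C(2n,n)` coefficient variables to the `C(2n',n')` variables — it becomes level ONE there since
  `C(2n,n)^A ≤ C(2n',n')` (`Dilation.pow_centralChoose_le_of_le`); hit it at `n'`; restrict-and-
  truncate the hitting polynomial back to `n` variables at size `≤ n^(b+4)`
  (`Dilation.exists_restrict`, `Dilation.restrict_arith`).)  The tree has this move only for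
  boolean-sum EQUATIONS (`Dilation.eq_dilate`, whose conclusion re-existentialises the number `q` of
  summed variables and so does not specialise to distinguishers, `q = 0`), and the level-raising
  `LevelOne.level_succ`, whose size exponent grows with the level (`stub_restrict`).
* `Uniform.levels_of_levelOne` — level one with exponent `b` from `n₀` on gives EVERY level `a` with
  the SAME exponent `b + 4` (from `max n₀ (8 (2 max(a,1))^(b+1) + 2)` on).
* `Uniform.succinctHittingSetsForVP_iff_uniform` — **UNIFORM SUCCINCTNESS**:
  `Q6 ↔ ∃ b, ∀ a, ∃ n₀, ∀ n ≥ n₀, hit(n, b, a)` — one succinctness exponent `b*` (`= b₁ + 4`,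
  `b₁` the level-one exponent) serves all distinguisher levels `poly(N)`.
* `Uniform.naturalProofs_ceiling` / `Uniform.fixedSize_defeats_all_levels` — **fixed-polynomial
  ceiling**: under `Q6` ONE size bound `n^(b*)` already defeats algebraically natural proofs of every
  constructivity level `a` against every target family.
* `Uniform.not_succinctHittingSetsForVP_iff_levelFree` — **level-free refutation**:
  `¬ Q6 ↔ ∀ b, ∃ a, ∀ n₀, ∃ n ≥ n₀, ∃ D, IsNaturalProof (…) (SmallCircuits ℂ n b) (Distinguishers ℂ n a) D`
  — to refute Question 6 it suffices to exhibit, for each size exponent `b`, natural proofs of SOME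
  level `a(b)` (allowed to grow with `b`) infinitely often; with the tree's level collapse
  (`succinctHittingSetsForVP_iff_levelOne`) this is further equivalent to level-ONE natural proofs
  i.o. against every `n^b` (`Uniform.levelFree_iff_levelOne_io`).

Sources: [cite: ForbesShpilkaVolk2018, Def. 1, Def. 3, Thm. 4, Cor. 5, Question 6]; the
non-uniformity of the exponent is the reason Chatterjee–Tengse (arXiv:2309.07612 v1, §4.3) pass to
a slightly super-polynomial universal circuit `t(n) = n^{f(n)}`, `f = ω(1)`; the padding /
restriction arithmetic is [folklore].
-/

-- layout Summits/ValiantsHypothesis/ValiantsHypothesis forces the duplicated namespace component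
set_option linter.dupNamespace false

namespace Summit.ValiantsHypothesis.ValiantsHypothesis.Theorems.BarrierLever.SuccinctHittingSetsForVP

open Literature.Barriers.ValiantsHypothesis Literature.Computability.AlgebraicComplexity MvPolynomial
open Summit.ValiantsHypothesis.ValiantsHypothesis.Theorems.BarrierLeverDefinableEquations

namespace Uniform

/-! ## §1 The distinguisher dilation -/

/-- **Padding lowers the level to one.** A level-`A` distinguisher in the `C(2n,n)` coefficient
variables, renamed along the zero-padding of exponents `degLEMonomials n ↪ degLEMonomials n'`
(`n ≤ n'`, `A n ≤ n'`), is a level-ONE distinguisher in the `C(2n',n')` variables: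
`complexity` and `totalDegree` do not grow under `rename`, and `C(2n,n)^A ≤ C(2n',n')`
(`Dilation.pow_centralChoose_le_of_le`). [cite: ForbesShpilkaVolk2018, Cor. 5 and Question 6] -/
theorem rename_pad_mem_distinguishers_one {A n n' : ℕ} (hnn' : n ≤ n') (hlo : A * n ≤ n')
    {D : MvPolynomial (degLEMonomials n) ℂ} (hD : D ∈ Distinguishers ℂ n A) :
    rename ((LevelOne.mapsTo_pad hnn').restrict _ _ _) D ∈ Distinguishers ℂ n' 1 := by
  simp only [Distinguishers, Set.mem_setOf_eq, pow_one] at hD ⊢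
  have hN : Nat.choose (2 * n) n ^ A ≤ Nat.choose (2 * n') n' :=
    Dilation.pow_centralChoose_le_of_le hlo
  exact ⟨(complexity_rename_le_holds' _ D).trans (hD.1.trans hN),
    (totalDegree_rename_le _ D).trans (hD.2.trans hN)⟩

/-- **THE DISTINGUISHER DILATION.** For `1 ≤ A`, `n ≥ 8 (2A)^(b+1) + 2` and
`A n ≤ n' < A (n+1)`: if the coefficient vectors of `SmallCircuits ℂ n' b` hit every nonzero
level-ONE distinguisher in the `C(2n',n')` coefficient variables, then the coefficient vectors of
`SmallCircuits ℂ n (b+4)` hit every nonzero level-`A` distinguisher in the `C(2n,n)` variables.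
Proof: pad the distinguisher (`rename_pad_mem_distinguishers_one`; nonzero by injectivity of the
padding), hit it at `n'` by some `f'`, and restrict-and-truncate `f'` to `g` in `n` variables of
degree `≤ n` and size `≤ n^(b+4)` with the same coefficients on the padded exponents
(`Dilation.exists_restrict`, `Dilation.restrict_arith`); then `D(coeff g) = (pad D)(coeff f') ≠ 0`
(`eval_rename`). [cite: ForbesShpilkaVolk2018, Question 6] -/
theorem hit_dilate {A b n n' : ℕ} (hA : 1 ≤ A) (hK : 8 * (2 * A) ^ (b + 1) + 2 ≤ n)
    (hlo : A * n ≤ n') (hhi : n' + 1 ≤ A * (n + 1))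
    (h : IsSuccinctHittingSet (degLEMonomials n') (SmallCircuits ℂ n' b) (Distinguishers ℂ n' 1)) :
    IsSuccinctHittingSet (degLEMonomials n) (SmallCircuits ℂ n (b + 4)) (Distinguishers ℂ n A) := by
  intro D hD hD0
  have hnn' : n ≤ n' := by
    have : 1 * n ≤ A * n := Nat.mul_le_mul_right n hA
    omega
  -- pad the distinguisher to the `C(2n',n')` variables: level one there, still nonzero
  have hD' := rename_pad_mem_distinguishers_one hnn' hlo hD
  have hD'0 : rename ((LevelOne.mapsTo_pad hnn').restrict _ _ _) D ≠ 0 := fun h0 =>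
    hD0 (rename_injective _ (LevelOne.restrict_pad_injective hnn') (by rw [h0, map_zero]))
  -- level one at `n'` variables hits it
  obtain ⟨f', hf', hne⟩ := h _ hD' hD'0
  -- restrict-and-truncate `f'` back to `n` variables, degree `≤ n`, size `≤ n^(b+4)`
  obtain ⟨g, hgdeg, hgc, hcoeff⟩ := Dilation.exists_restrict hnn' f' hf'
  refine ⟨g, ⟨hgdeg, hgc.trans (Dilation.restrict_arith hA hK hhi)⟩, ?_⟩
  have hvec : coeffVector (degLEMonomials n) g =
      coeffVector (degLEMonomials n') f' ∘ (LevelOne.mapsTo_pad hnn').restrict _ _ _ := by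
    funext m
    simp only [coeffVector_apply, Function.comp_apply, Set.MapsTo.val_restrict_apply]
    exact hcoeff m m.2
  rw [hvec, ← eval_rename]
  exact hne

/-- **Every level from level one, with ONE exponent.** If level one is hit with size exponent `b`
from `n₀` on, then every level `a` is hit with the SAME exponent `b + 4`, from
`max n₀ (8 (2 max(a,1))^(b+1) + 2)` on (dilate by `A = max a 1`, `n' = A n`; `hit_dilate`;
monotonicity in the level). [cite: ForbesShpilkaVolk2018, Question 6] -/
theorem levels_of_levelOne {b n₀ : ℕ}
    (hb : ∀ n : ℕ, n₀ ≤ n →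
      IsSuccinctHittingSet (degLEMonomials n) (SmallCircuits ℂ n b) (Distinguishers ℂ n 1))
    (a : ℕ) :
    ∀ n : ℕ, max n₀ (8 * (2 * max a 1) ^ (b + 1) + 2) ≤ n →
      IsSuccinctHittingSet (degLEMonomials n) (SmallCircuits ℂ n (b + 4))
        (Distinguishers ℂ n a) := by
  intro n hn
  have hA : 1 ≤ max a 1 := le_max_right _ _
  have hK : 8 * (2 * max a 1) ^ (b + 1) + 2 ≤ n := (le_max_right _ _).trans hn
  have hn₀ : n₀ ≤ n := (le_max_left _ _).trans hn
  have hnAn : n ≤ max a 1 * n := by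
    have : 1 * n ≤ max a 1 * n := Nat.mul_le_mul_right n hA
    omega
  have hhi : max a 1 * n + 1 ≤ max a 1 * (n + 1) := by
    rw [mul_add, mul_one]
    omega
  refine (hit_dilate hA hK le_rfl hhi (hb (max a 1 * n) (hn₀.trans hnAn))).mono le_rfl ?_
  -- monotonicity of the distinguisher class in the level, `N^a ≤ N^(max a 1)` (inlined: the
  -- named lemma is `BarrierLever.NaturalProofsSeparateVNP.distinguishers_mono`, not imported here)
  intro D hD
  simp only [Distinguishers, Set.mem_setOf_eq] at hD ⊢
  have hN : Nat.choose (2 * n) n ^ a ≤ Nat.choose (2 * n) n ^ max a 1 :=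
    Nat.pow_le_pow_right (Nat.choose_pos (by omega)) (le_max_left a 1)
  exact ⟨hD.1.trans hN, hD.2.trans hN⟩

/-! ## §2 Uniform succinctness -/

/-- **Uniform succinctness from level one**: a level-one exponent `b₁` (from some `n₀` on) yields the
SINGLE exponent `b* = b₁ + 4` hitting every level `a`, each from its own threshold on.
[cite: ForbesShpilkaVolk2018, Question 6] -/
theorem uniform_of_levelOne
    (h : ∃ b n₀ : ℕ, ∀ n : ℕ, n₀ ≤ n →
      IsSuccinctHittingSet (degLEMonomials n) (SmallCircuits ℂ n b) (Distinguishers ℂ n 1)) :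
    ∃ b : ℕ, ∀ a : ℕ, ∃ n₀ : ℕ, ∀ n : ℕ, n₀ ≤ n →
      IsSuccinctHittingSet (degLEMonomials n) (SmallCircuits ℂ n b) (Distinguishers ℂ n a) := by
  obtain ⟨b, n₀, hb⟩ := h
  exact ⟨b + 4, fun a => ⟨_, levels_of_levelOne hb a⟩⟩

/-- **UNIFORM SUCCINCTNESS (Question 6 ⟺ its uniform form).** Forbes–Shpilka–Volk's Question 6
over `ℂ` in the tree's regime, `∀ a, ∃ b n₀, ∀ n ≥ n₀, hit(n, b, a)`, is equivalent to the
exponent-UNIFORM statement `∃ b, ∀ a, ∃ n₀, ∀ n ≥ n₀, hit(n, b, a)`: ONE succinctness exponent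
serves every distinguisher level `poly(N)` (instantiate `a := 1`, then `uniform_of_levelOne`).
[cite: ForbesShpilkaVolk2018, Question 6] -/
theorem succinctHittingSetsForVP_iff_uniform :
    Literature.Barriers.ValiantsHypothesis.SuccinctHittingSetsForVP ℂ ↔
      ∃ b : ℕ, ∀ a : ℕ, ∃ n₀ : ℕ, ∀ n : ℕ, n₀ ≤ n →
        IsSuccinctHittingSet (degLEMonomials n) (SmallCircuits ℂ n b) (Distinguishers ℂ n a) :=
  ⟨fun h => uniform_of_levelOne (h 1), fun ⟨b, hb⟩ a => ⟨b, hb a⟩⟩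

/-- The same equivalence for the route's crux constant `BarrierLever.SuccinctHittingSetsForVP`
(item stmt-ValiantsHypothesis-14610), which unfolds to the Literature constant by `rfl`.
[cite: ForbesShpilkaVolk2018, Question 6] -/
theorem crux_iff_uniform :
    Summit.ValiantsHypothesis.ValiantsHypothesis.Theses.BarrierLever.SuccinctHittingSetsForVP ↔
      ∃ b : ℕ, ∀ a : ℕ, ∃ n₀ : ℕ, ∀ n : ℕ, n₀ ≤ n →
        IsSuccinctHittingSet (degLEMonomials n) (SmallCircuits ℂ n b) (Distinguishers ℂ n a) :=
  succinctHittingSetsForVP_iff_uniform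

/-! ## §3 Corollaries: the fixed-polynomial ceiling and the level-free refutation -/

/-- **Fixed-polynomial ceiling for natural proofs.** Under Question 6 there is ONE size exponent
`b*` such that for EVERY constructivity level `a`, eventually in `n`, there is no algebraically
natural proof of level `a` useful against `SmallCircuits ℂ n b*` at all (FSV Thm. 4 applied to the
uniform form). [cite: ForbesShpilkaVolk2018, Thm. 4 and Question 6] -/
theorem naturalProofs_ceiling
    (hyp : Literature.Barriers.ValiantsHypothesis.SuccinctHittingSetsForVP ℂ) :
    ∃ b : ℕ, ∀ a : ℕ, ∃ n₀ : ℕ, ∀ n : ℕ, n₀ ≤ n →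
      ¬ ∃ D, IsNaturalProof (degLEMonomials n) (SmallCircuits ℂ n b) (Distinguishers ℂ n a) D := by
  obtain ⟨b, hb⟩ := succinctHittingSetsForVP_iff_uniform.1 hyp
  refine ⟨b, fun a => ?_⟩
  obtain ⟨n₀, h⟩ := hb a
  refine ⟨n₀, fun n hn => ?_⟩
  rw [exists_isNaturalProof_iff, not_not]
  exact h n hn

/-- **One polynomial size bound defeats all levels against every target.** Under Question 6 there
is ONE `b*` such that for every level `a` and every target family `h = (h_n)`, natural proofs of
level `a` useful against size `n^(b*)` and nonzero at `h_n` do NOT exist infinitely often — the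
natural method cannot certify even `L(h_n) > n^(b*)` i.o., whatever the level (compare
`not_naturalProofAgainstVP`, where the defeated size exponent depends on `a`).
[cite: ForbesShpilkaVolk2018, Cor. 5 and Question 6] -/
theorem fixedSize_defeats_all_levels
    (hyp : Literature.Barriers.ValiantsHypothesis.SuccinctHittingSetsForVP ℂ) :
    ∃ b : ℕ, ∀ (a : ℕ) (h : ∀ n, MvPolynomial (Fin n) ℂ),
      ¬ ∀ n₀ : ℕ, ∃ n : ℕ, n₀ ≤ n ∧ ∃ D : MvPolynomial (degLEMonomials n) ℂ,
        IsNaturalProof (degLEMonomials n) (SmallCircuits ℂ n b) (Distinguishers ℂ n a) D ∧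
          eval (coeffVector (degLEMonomials n) (h n)) D ≠ 0 := by
  obtain ⟨b, hb⟩ := naturalProofs_ceiling hyp
  refine ⟨b, fun a h hio => ?_⟩
  obtain ⟨n₀, hn₀⟩ := hb a
  obtain ⟨n, hn, D, hD, -⟩ := hio n₀
  exact hn₀ n hn ⟨D, hD⟩

/-- **LEVEL-FREE REFUTATION.** Question 6 over `ℂ` FAILS iff for every size exponent `b` there is
SOME level `a = a(b)` — allowed to grow with `b` — with level-`a` natural proofs useful against
`SmallCircuits ℂ n b` for infinitely many `n`.  (As printed, `¬ Q6` asks for ONE level `a` working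
against every `b`; the dilation removes that uniformity from the refuter's burden.)
[cite: ForbesShpilkaVolk2018, Thm. 4 and Question 6] -/
theorem not_succinctHittingSetsForVP_iff_levelFree :
    ¬ Literature.Barriers.ValiantsHypothesis.SuccinctHittingSetsForVP ℂ ↔
      ∀ b : ℕ, ∃ a : ℕ, ∀ n₀ : ℕ, ∃ n : ℕ, n₀ ≤ n ∧
        ∃ D, IsNaturalProof (degLEMonomials n) (SmallCircuits ℂ n b) (Distinguishers ℂ n a) D := by
  rw [succinctHittingSetsForVP_iff_uniform]
  push Not
  simp only [exists_isNaturalProof_iff]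

/-- **Level-one refutation** (the tree's level collapse `succinctHittingSetsForVP_iff_levelOne`,
negated): Question 6 over `ℂ` FAILS iff for every size exponent `b`, level-ONE natural proofs
useful against `SmallCircuits ℂ n b` exist for infinitely many `n`.
[cite: ForbesShpilkaVolk2018, Thm. 4 and Question 6] -/
theorem not_succinctHittingSetsForVP_iff_levelOne_io :
    ¬ Literature.Barriers.ValiantsHypothesis.SuccinctHittingSetsForVP ℂ ↔
      ∀ b n₀ : ℕ, ∃ n : ℕ, n₀ ≤ n ∧
        ∃ D, IsNaturalProof (degLEMonomials n) (SmallCircuits ℂ n b) (Distinguishers ℂ n 1) D := by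
  rw [show Literature.Barriers.ValiantsHypothesis.SuccinctHittingSetsForVP ℂ ↔ _ from
    succinctHittingSetsForVP_iff_levelOne]
  push Not
  simp only [exists_isNaturalProof_iff]

/-- **Growing levels are as good as level one.** Natural proofs against every polynomial size at
levels allowed to grow with the size exponent exist (i.o.) iff they exist at level ONE (i.o.,
against every polynomial size) — both being equivalent to `¬ Q6`.
[cite: ForbesShpilkaVolk2018, Question 6] -/
theorem levelFree_iff_levelOne_io :
    (∀ b : ℕ, ∃ a : ℕ, ∀ n₀ : ℕ, ∃ n : ℕ, n₀ ≤ n ∧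
        ∃ D, IsNaturalProof (degLEMonomials n) (SmallCircuits ℂ n b) (Distinguishers ℂ n a) D) ↔
      ∀ b n₀ : ℕ, ∃ n : ℕ, n₀ ≤ n ∧
        ∃ D, IsNaturalProof (degLEMonomials n) (SmallCircuits ℂ n b) (Distinguishers ℂ n 1) D :=
  not_succinctHittingSetsForVP_iff_levelFree.symm.trans not_succinctHittingSetsForVP_iff_levelOne_io

end Uniform

end Summit.ValiantsHypothesis.ValiantsHypothesis.Theorems.BarrierLever.SuccinctHittingSetsForVP
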